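import Summits.QuantumFields.YangMills.Theorems.ColdStartUniversalityLatticeLangevinGeneratorCalculus
import Mathlib.Analysis.Calculus.Deriv.Comp
import Mathlib.Analysis.Calculus.IteratedDeriv.Defs
import Mathlib.Analysis.SpecialFunctions.Log.Deriv
import HarnessLib

/-!
# The CHAIN RULE (diffusion property) for a second-order generator in coordinates:
# `𝓛(φ∘w) = φ'(w)·𝓛w + ½ φ''(w)·Γ(w,w)` for `φ : ℝ → ℝ` of class `C²`

Seat `ym-line-csu-p1` (g43), route `ColdStartUniversality` of `Summits/QuantumFields/YangMills`, helper file (`--supports stmt-QuantumFields-24809`).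
Companion to `…GeneratorCalculus` (g7: Leibniz rule, exponentials): for the coordinate generator
`𝓛 f(y) = Σ_i ∂_{v_i} f(y) b_i + ½ Σ_i Σ_j ∂_{v_j}∂_{v_i} f(y) A_{ij}` and its carré du champ `Γ(f,g) = Σ_{ij} ∂_i f ∂_j g A_{ij}`:
* `fderiv_comp_real_apply`, `fderiv_fderiv_comp_real_apply` — first and second directional derivatives of `φ ∘ w`;
* ★★ `generator_comp_real` — `𝓛(φ∘w)(y) = φ'(w y)·𝓛w(y) + ½ φ''(w y)·Γ(w,w)(y)` (Bakry–Émery's diffusion property; with `φ = log` this is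
  `𝓛 log g = 𝓛g/g − ½Γ(g,g)/g²` in this normalisation, the identity behind entropy/Fisher computations and Wang's log-Harnack inequality);
* ★ `generator_log` — the logarithmic case spelled out for `w > 0`.
Pure calculus; THEOREMS ONLY, no definition, no sorry.  HONEST FRAMING: infrastructure for the semigroup calculus of the fixed-cut-off package; nothing
here bears on the mass gap; no crux, rung or summit statement is proved; the Yang–Mills mass gap is NOT proved.
-/

set_option autoImplicit false

noncomputable section

namespace Summit.QuantumFields.YangMills.Theorems.ColdStartUniversality

open Finset
open scoped BigOperators

variable {E : Type*} [NormedAddCommGroup E] [NormedSpace ℝ E]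

/-- `∂_v (φ∘w)(y) = φ'(w y)·∂_v w(y)`. [folklore] -/
theorem fderiv_comp_real_apply {w : E → ℝ} {φ : ℝ → ℝ} {y : E} (hw : DifferentiableAt ℝ w y) (hφ : DifferentiableAt ℝ φ (w y)) (v : E) :
    fderiv ℝ (fun z => φ (w z)) y v = deriv φ (w y) * fderiv ℝ w y v := by
  have h := (hφ.hasDerivAt.comp_hasFDerivAt y hw.hasFDerivAt).fderiv
  rw [show (fun z => φ (w z)) = φ ∘ w from rfl, h]
  simp only [FunLike.coe_smul, Pi.smul_apply, smul_eq_mul]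

/-- For `C²` data, `z ↦ φ'(w z)` is differentiable with `∂_v (φ'∘w)(y) = φ''(w y)·∂_v w(y)`. [folklore] -/
theorem fderiv_deriv_comp_real_apply {w : E → ℝ} {φ : ℝ → ℝ} (hw : ContDiff ℝ 2 w) (hφ : ContDiff ℝ 2 φ) (y v : E) :
    fderiv ℝ (fun z => deriv φ (w z)) y v = deriv (deriv φ) (w y) * fderiv ℝ w y v := by
  have hφ' : ContDiff ℝ 1 (deriv φ) := by
    have := hφ.iterate_deriv' 1 1; simpa using this
  exact fderiv_comp_real_apply ((hw.differentiable (by norm_num)) y) ((hφ'.differentiable (by norm_num)) (w y)) v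

/-- `∂_u ∂_t (φ∘w)(y) = φ''(w y)·∂_u w(y)·∂_t w(y) + φ'(w y)·∂_u∂_t w(y)`. [folklore] -/
theorem fderiv_fderiv_comp_real_apply {w : E → ℝ} {φ : ℝ → ℝ} (hw : ContDiff ℝ 2 w) (hφ : ContDiff ℝ 2 φ) (y t u : E) :
    fderiv ℝ (fun z => fderiv ℝ (fun z' => φ (w z')) z t) y u =
      deriv (deriv φ) (w y) * fderiv ℝ w y u * fderiv ℝ w y t + deriv φ (w y) * fderiv ℝ (fun z => fderiv ℝ w z t) y u := by
  have hwd : Differentiable ℝ w := hw.differentiable (by norm_num)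
  have hφd : Differentiable ℝ φ := hφ.differentiable (by norm_num)
  have hφ' : ContDiff ℝ 1 (deriv φ) := by
    have := hφ.iterate_deriv' 1 1; simpa using this
  have h1 : (fun z => fderiv ℝ (fun z' => φ (w z')) z t) = fun z => deriv φ (w z) * fderiv ℝ w z t := by
    funext z; exact fderiv_comp_real_apply (hwd z) (hφd (w z)) t
  rw [h1]
  have hA : DifferentiableAt ℝ (fun z => deriv φ (w z)) y := ((hφ'.differentiable (by norm_num)) (w y)).comp y (hwd y)
  have hB : DifferentiableAt ℝ (fun z => fderiv ℝ w z t) y := differentiableAt_fderiv_apply_const hw y t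
  rw [fderiv_mul_apply_dir hA hB, fderiv_deriv_comp_real_apply hw hφ y u]
  ring

/-- ★★ **Chain rule for the generator (diffusion property)**: for `C²` functions `w : E → ℝ`, `φ : ℝ → ℝ`, directions `v`, drift `b` and diffusion matrix `A`,
`𝓛(φ∘w)(y) = φ'(w y)·𝓛w(y) + ½·φ''(w y)·Σ_{ij} ∂_i w ∂_j w A_{ij}`. [cite: BakryGentilLedoux2014, (1.11.4)] -/
theorem generator_comp_real {ι : Type*} [Fintype ι] (v : ι → E) (b : ι → ℝ) (A : ι → ι → ℝ)
    {w : E → ℝ} (hw : ContDiff ℝ 2 w) {φ : ℝ → ℝ} (hφ : ContDiff ℝ 2 φ) (y : E) :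
    (∑ i, fderiv ℝ (fun z => φ (w z)) y (v i) * b i +
        1 / 2 * ∑ i, ∑ j, fderiv ℝ (fun z => fderiv ℝ (fun z' => φ (w z')) z (v i)) y (v j) * A i j) =
      deriv φ (w y) * (∑ i, fderiv ℝ w y (v i) * b i + 1 / 2 * ∑ i, ∑ j, fderiv ℝ (fun z => fderiv ℝ w z (v i)) y (v j) * A i j) +
        1 / 2 * deriv (deriv φ) (w y) * ∑ i, ∑ j, fderiv ℝ w y (v i) * fderiv ℝ w y (v j) * A i j := by
  have hwd : Differentiable ℝ w := hw.differentiable (by norm_num)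
  have hφd : Differentiable ℝ φ := hφ.differentiable (by norm_num)
  simp_rw [fderiv_comp_real_apply (hwd y) (hφd (w y)), fderiv_fderiv_comp_real_apply hw hφ]
  have h1 : ∑ i, deriv φ (w y) * fderiv ℝ w y (v i) * b i = deriv φ (w y) * ∑ i, fderiv ℝ w y (v i) * b i := by
    rw [Finset.mul_sum]; exact Finset.sum_congr rfl fun i _ => by ring
  have h2 : ∑ i, ∑ j, (deriv (deriv φ) (w y) * fderiv ℝ w y (v j) * fderiv ℝ w y (v i) +
      deriv φ (w y) * fderiv ℝ (fun z => fderiv ℝ w z (v i)) y (v j)) * A i j =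
      deriv (deriv φ) (w y) * ∑ i, ∑ j, fderiv ℝ w y (v i) * fderiv ℝ w y (v j) * A i j +
      deriv φ (w y) * ∑ i, ∑ j, fderiv ℝ (fun z => fderiv ℝ w z (v i)) y (v j) * A i j := by
    simp only [Finset.mul_sum]
    rw [← Finset.sum_add_distrib]
    refine Finset.sum_congr rfl fun i _ => ?_
    rw [← Finset.sum_add_distrib]
    exact Finset.sum_congr rfl fun j _ => by ring
  rw [h1, h2]; ring

/-- ★ **The logarithmic case**: for a `C²` function `w > 0`,
`𝓛(log∘w)(y) = 𝓛w(y)/w(y) − ½·Γ(w,w)(y)/w(y)²` — the identity `𝓛 log g = 𝓛g/g − Γ(g)/g²` (with this file's `½Σ A ∂∂` normalisation of `𝓛` and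
`Γ(w,w) = Σ_{ij} ∂_i w ∂_j w A_{ij}`) behind Fisher-information and log-Harnack computations. [cite: BakryGentilLedoux2014, (1.11.4)] -/
theorem generator_log {ι : Type*} [Fintype ι] (v : ι → E) (b : ι → ℝ) (A : ι → ι → ℝ)
    {w : E → ℝ} (hw : ContDiff ℝ 2 w) (hpos : ∀ z, 0 < w z) (y : E) :
    (∑ i, fderiv ℝ (fun z => Real.log (w z)) y (v i) * b i +
        1 / 2 * ∑ i, ∑ j, fderiv ℝ (fun z => fderiv ℝ (fun z' => Real.log (w z')) z (v i)) y (v j) * A i j) =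
      (w y)⁻¹ * (∑ i, fderiv ℝ w y (v i) * b i + 1 / 2 * ∑ i, ∑ j, fderiv ℝ (fun z => fderiv ℝ w z (v i)) y (v j) * A i j) -
        1 / 2 * ((w y) ^ 2)⁻¹ * ∑ i, ∑ j, fderiv ℝ w y (v i) * fderiv ℝ w y (v j) * A i j := by
  have hwd : Differentiable ℝ w := hw.differentiable (by norm_num)
  have hfirst : ∀ z u, fderiv ℝ (fun z => Real.log (w z)) z u = (w z)⁻¹ * fderiv ℝ w z u := fun z u => by
    rw [fderiv_comp_real_apply (hwd z) (Real.differentiableAt_log (hpos z).ne'), Real.deriv_log]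
  have hinvd : ∀ z, DifferentiableAt ℝ (fun z => (w z)⁻¹) z := fun z => (hwd z).inv (hpos z).ne'
  have hsecond : ∀ i j, fderiv ℝ (fun z => fderiv ℝ (fun z' => Real.log (w z')) z (v i)) y (v j) =
      -((w y) ^ 2)⁻¹ * fderiv ℝ w y (v j) * fderiv ℝ w y (v i) + (w y)⁻¹ * fderiv ℝ (fun z => fderiv ℝ w z (v i)) y (v j) := by
    intro i j
    have h1 : (fun z => fderiv ℝ (fun z' => Real.log (w z')) z (v i)) = fun z => (w z)⁻¹ * fderiv ℝ w z (v i) := funext fun z => hfirst z (v i)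
    rw [h1, fderiv_mul_apply_dir (hinvd y) (differentiableAt_fderiv_apply_const hw y (v i))]
    have hinv : fderiv ℝ (fun z => (w z)⁻¹) y (v j) = -((w y) ^ 2)⁻¹ * fderiv ℝ w y (v j) := by
      rw [fderiv_comp_real_apply (φ := fun r : ℝ => r⁻¹) (hwd y) (differentiableAt_inv (hpos y).ne'), deriv_inv]
    rw [hinv]; ring
  simp_rw [hfirst y, hsecond]
  have h1 : ∑ i, (w y)⁻¹ * fderiv ℝ w y (v i) * b i = (w y)⁻¹ * ∑ i, fderiv ℝ w y (v i) * b i := by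
    rw [Finset.mul_sum]; exact Finset.sum_congr rfl fun i _ => by ring
  have h2 : ∑ i, ∑ j, (-((w y) ^ 2)⁻¹ * fderiv ℝ w y (v j) * fderiv ℝ w y (v i) + (w y)⁻¹ * fderiv ℝ (fun z => fderiv ℝ w z (v i)) y (v j)) * A i j =
      -((w y) ^ 2)⁻¹ * ∑ i, ∑ j, fderiv ℝ w y (v i) * fderiv ℝ w y (v j) * A i j +
      (w y)⁻¹ * ∑ i, ∑ j, fderiv ℝ (fun z => fderiv ℝ w z (v i)) y (v j) * A i j := by
    simp only [Finset.mul_sum]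
    rw [← Finset.sum_add_distrib]
    refine Finset.sum_congr rfl fun i _ => ?_
    rw [← Finset.sum_add_distrib]
    exact Finset.sum_congr rfl fun j _ => by ring
  rw [h1, h2]; ring

end Summit.QuantumFields.YangMills.Theorems.ColdStartUniversality
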